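import Summits.ResolutionOfSingularities.ResolutionOfSingularities.Theorems.PurelyInseparableDim4ResConeTwoSlotGameFree
import Summits.ResolutionOfSingularities.ResolutionOfSingularities.Theorems.PurelyInseparableDim4ExceptionalFreeRun
import HarnessLib
import HarnessLib.Audit.Tags

/-!
# Purely inseparable four-folds — TWO-SLOT GAME ON A WINDOW: a letter change freezes the slot for as long as the readings are
# supplied, and a window of slot-`A` steps is a free run bounded by `μ⁺` (cell `res-dim4-pi`, K2(p) lane, slice B brick K24a,
# R1″ part (W1))

[OURS · counted 0 · cell `res-dim4-pi` · K2(p) lane (holder res-dim4-p-12 g3; K24a-R1″ window route, bus 2026-08-29 04:31Z /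
HOME `K24a-ROTATION-MEMO.md` §4); the game = res-dim4-idea-4 g3; seat res-dim4-p-1 g4 over `…TwoSlotGameFree` (γ₀′) and
`ExceptionalLength.free_run_length_add_two_le_jetColength` ((Λ3), the quantitative free-tail theorem).]  Nothing here proves
K2(p)/K2(5), `NoIsolatedTrap p p` or resolution of singularities in dimension ≥ 4 / characteristic `p`.  AI kernel work, weaker
than expert review.

WHY.  On the window route the readings of idea-4's game are supplied only for finitely many steps after a letter change (the
virtual framed chain is followed through a re-presentation of finite level).  So:

* §1 **`twoSlot_letterChange_freezes_window`** — hypotheses at times `< W` (relabelings, flag) / `≤ W` (legality); after a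
  letter change `λ` at `k`, `μ` at `k + 1` with `k + 2 ≤ W`: every step `m` with `k + 2 ≤ m < W` is a `λ`-step (and
  `s m 1 2 0 ≠ 0`).  Same proof as `twoSlot_letterChange_freezes'`, induction stopped at `W`.
* §2 **`slot_run_length_le`** — SLOT BOOKKEEPING ⇒ BOUNDED RUN: a run of slot-`A` steps `L m` for `N₀ ≤ m < N₀ + n + 1` (with
  `A (m+1) = j (k₁+m)`, `j (k₁+m) = A m ∨ b (k₁+m) (A m) ≠ 0` on it) makes the real moves `k₁+N₀+1, …, k₁+N₀+n` E-free, so an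
  isolation certificate at `c (k₁+N₀)` gives `n + 2 ≤ μ⁺(c (k₁+N₀))` ((Λ3)).
* §3 **`no_twoSlot_window_of_readings`** — the two together: a letter change at `(k, k+1)`, readings on the window
  `[k, k + μ⁺ + 4]`, slot bookkeeping, and a certificate at the real time of `k + 2` are contradictory.

[cite: CossartJannsenSaito2020, Thm. 3.14] [cite: Kollar2007, Theorem 3.76] bears_on: LADDER-RESOLUTION:D157-DOOR2 (res-dim4-pi ·
K2(p) · slice B · K24a-R1″ (W1)).  Supports stmt-ResolutionOfSingularities-16155 (helper).
-/

set_option linter.dupNamespace false -- mandated namespace of this single-conjunct summit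

namespace Summit.ResolutionOfSingularities.ResolutionOfSingularities.Theorems.PIDim4

namespace ResCone

open Literature.AlgebraicGeometry.Resolution
open Literature.AlgebraicGeometry.Resolution.CentreBlowup

variable {K : Type} [Field K]

/-! ## 1. The game on a window -/

/-- **THE LETTER CHANGE FREEZES THE SLOT ON A WINDOW**: readings supplied at times `< W` (relabelings as implications, flag) and
`≤ W` (legality); if step `k` is `λ`, step `k + 1` is `μ` and `k + 2 ≤ W`, then every `m` with `k + 2 ≤ m < W` is a `λ`-step with
`s m 1 2 0 ≠ 0`. [OURS · idea-4's argument, windowed] [folklore] -/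
theorem twoSlot_letterChange_freezes_window {s t : ℕ → ℕ → ℕ → ℕ → K} {L : ℕ → Prop} {W : ℕ}
    (hfix : ∀ m, m < W → L m → s m 1 2 0 ≠ 0 → s (m + 1) 1 2 0 ≠ 0)
    (hmuA : ∀ m, m < W → ¬ L m → s m 1 2 0 ≠ 0 → s (m + 1) 1 1 0 ≠ 0)
    (hmuB : ∀ m, m < W → ¬ L m → s m 1 3 0 ≠ 0 → s (m + 1) 1 2 0 ≠ 0)
    (hlegL : ∀ m, m ≤ W → L m → s m 1 1 0 = 0)
    (hlegM : ∀ m, m ≤ W → ¬ L m → s m 0 2 0 = 0 ∧ s m 1 1 0 = 0 ∧ s m 0 1 1 = 0 ∧ t m 0 1 0 = 0)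
    (hflag : ∀ m, m < W → L m → s (m + 1) 0 2 0 ≠ 0 ∨ s (m + 1) 1 1 0 ≠ 0 ∨ s (m + 1) 0 1 1 ≠ 0 ∨
      s (m + 1) 1 2 0 ≠ 0 ∨ s (m + 1) 1 3 0 ≠ 0 ∨ t (m + 1) 0 1 0 ≠ 0)
    {k : ℕ} (hk : L k) (hk1 : ¬ L (k + 1)) (hkW : k + 2 ≤ W) :
    ∀ m, k + 2 ≤ m → m < W → L m ∧ s m 1 2 0 ≠ 0 := by
  -- `x_λ x_μ ∈ S₀` is illegal for both letters (times `≤ W`)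
  have hkill : ∀ m, m ≤ W → s m 1 1 0 ≠ 0 → False := fun m hm h => by
    by_cases hL : L m
    · exact h (hlegL m hm hL)
    · exact h (hlegM m hm hL).2.1
  -- a `μ`-step on `x_λ x_μ² ∈ S₀` is fatal one step later (times `< W`)
  have hstay : ∀ m, m < W → s m 1 2 0 ≠ 0 → L m := fun m hm h => by
    by_contra hL
    exact hkill (m + 1) (by omega) (hmuA m hm hL h)
  -- the flag at `k + 1` leaves only `x_λ x_μ³`
  have h130 : s (k + 1) 1 3 0 ≠ 0 := by
    obtain ⟨h020, h110, h011, h010⟩ := hlegM (k + 1) (by omega) hk1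
    rcases hflag k (by omega) hk with h | h | h | h | h | h
    · exact absurd h020 h
    · exact absurd h110 h
    · exact absurd h011 h
    · exact (hkill (k + 2) hkW (hmuA (k + 1) (by omega) hk1 h)).elim
    · exact h
    · exact absurd h010 h
  have h120 : s (k + 2) 1 2 0 ≠ 0 := hmuB (k + 1) (by omega) hk1 h130
  intro m hm hmW
  induction m, hm using Nat.le_induction with
  | base => exact ⟨hstay _ hmW h120, h120⟩
  | succ m hm ih =>
    have ih' := ih (by omega)
    have h' : s (m + 1) 1 2 0 ≠ 0 := hfix m (by omega) ih'.1 ih'.2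
    exact ⟨hstay _ hmW h', h'⟩

/-! ## 2. A window of slot-`A` steps is a bounded free run -/

section Run

variable (p : ℕ) [Fact p.Prime] [CharP K p] [DecidableEq K]

/-- **A RUN OF SLOT-`A` STEPS IS BOUNDED BY `μ⁺`** (slot bookkeeping + (Λ3)): if `L m` holds for `N₀ ≤ m ≤ N₀ + n + 1`, with
`A (m+1) = j (k₁+m)` after every such step and `j (k₁+m) = A m ∨ b (k₁+m) (A m) ≠ 0` at it, then the real moves
`k₁+N₀+1, …, k₁+N₀+n+1` are E-free, so an isolation certificate of `c (k₁+N₀+1)` at level `N` gives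
`n + 2 ≤ μ⁺ = jetColength p N (c (k₁+N₀+1)).F`. [OURS] [cite: Kollar2007, Theorem 3.76 (char p, m = p)] -/
theorem slot_run_length_le {c : ℕ → State K} {j : ℕ → Fin 4} {b : ℕ → Fin 4 → K}
    (hw : FreeTail.IsWitnessedChain p c j b) {k₁ N₀ n : ℕ} {A : ℕ → Fin 4} {L : ℕ → Prop}
    (hL : ∀ m, N₀ ≤ m → m ≤ N₀ + n + 1 → L m) (hA : ∀ m, N₀ ≤ m → m ≤ N₀ + n + 1 → L m → A (m + 1) = j (k₁ + m))
    (hstep : ∀ m, N₀ ≤ m → m ≤ N₀ + n + 1 → L m → j (k₁ + m) = A m ∨ b (k₁ + m) (A m) ≠ 0) {N : ℕ}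
    (hcert : RidgeBudget.IsCert p N (c (k₁ + N₀ + 1)).F) :
    n + 2 ≤ RidgeBudget.jetColength p N (c (k₁ + N₀ + 1)).F := by
  refine ExceptionalLength.free_run_length_add_two_le_jetColength p hw (k₁ + N₀ + 1) hcert fun m' hm1 hm2 hsat => ?_
  -- `m' = k₁ + m` with `N₀ + 1 ≤ m ≤ N₀ + n`; use the slot bookkeeping of steps `m` and `m + 1`
  obtain ⟨m, rfl⟩ : ∃ m, m' = k₁ + m := ⟨m' - k₁, by omega⟩
  have hLm' : L (m + 1) := hL (m + 1) (by omega) (by omega)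
  have hAm' : A (m + 1) = j (k₁ + m) := hA m (by omega) (by omega) (hL m (by omega) (by omega))
  rcases hstep (m + 1) (by omega) (by omega) hLm' with h' | h'
  · exact hsat.1 (by rw [show k₁ + m + 1 = k₁ + (m + 1) by omega, h', hAm'])
  · exact h' (by rw [hAm', ← show k₁ + m + 1 = k₁ + (m + 1) by omega]; exact hsat.2)

/-! ## 3. The window kill -/

/-- **THE TWO-SLOT WINDOW, MODULO ITS READINGS** (K24a-R1″ (W1)): a letter change `λ` at `k`, `μ` at `k + 1`, readings of the
game on the window `[0, W]`, slot-`λ` bookkeeping on `[k+2, W)`, and an isolation certificate of the real state at window time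
`k + 3` with `k + 4 + μ⁺ ≤ W` are contradictory: §1 makes `[k+2, W)` a run of `λ`-steps, §2 bounds its length by `μ⁺`. [OURS]
[cite: CossartJannsenSaito2020, Thm. 3.14] [cite: Kollar2007, Theorem 3.76] -/
theorem no_twoSlot_window_of_readings {c : ℕ → State K} {j : ℕ → Fin 4} {b : ℕ → Fin 4 → K}
    (hw : FreeTail.IsWitnessedChain p c j b) {k₁ : ℕ} {A : ℕ → Fin 4} {L : ℕ → Prop} {s t : ℕ → ℕ → ℕ → ℕ → K} {W : ℕ}
    (hfix : ∀ m, m < W → L m → s m 1 2 0 ≠ 0 → s (m + 1) 1 2 0 ≠ 0)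
    (hmuA : ∀ m, m < W → ¬ L m → s m 1 2 0 ≠ 0 → s (m + 1) 1 1 0 ≠ 0)
    (hmuB : ∀ m, m < W → ¬ L m → s m 1 3 0 ≠ 0 → s (m + 1) 1 2 0 ≠ 0)
    (hlegL : ∀ m, m ≤ W → L m → s m 1 1 0 = 0)
    (hlegM : ∀ m, m ≤ W → ¬ L m → s m 0 2 0 = 0 ∧ s m 1 1 0 = 0 ∧ s m 0 1 1 = 0 ∧ t m 0 1 0 = 0)
    (hflag : ∀ m, m < W → L m → s (m + 1) 0 2 0 ≠ 0 ∨ s (m + 1) 1 1 0 ≠ 0 ∨ s (m + 1) 0 1 1 ≠ 0 ∨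
      s (m + 1) 1 2 0 ≠ 0 ∨ s (m + 1) 1 3 0 ≠ 0 ∨ t (m + 1) 0 1 0 ≠ 0)
    {k : ℕ} (hk : L k) (hk1 : ¬ L (k + 1))
    (hA : ∀ m, k + 2 ≤ m → m < W → L m → A (m + 1) = j (k₁ + m))
    (hstep : ∀ m, k + 2 ≤ m → m < W → L m → j (k₁ + m) = A m ∨ b (k₁ + m) (A m) ≠ 0) {N : ℕ}
    (hcert : RidgeBudget.IsCert p N (c (k₁ + (k + 2) + 1)).F)
    (hW : k + 4 + RidgeBudget.jetColength p N (c (k₁ + (k + 2) + 1)).F ≤ W) : False := by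
  have hrun := twoSlot_letterChange_freezes_window hfix hmuA hmuB hlegL hlegM hflag hk hk1 (by omega)
  have h := slot_run_length_le p hw (k₁ := k₁) (N₀ := k + 2) (n := W - k - 4) (A := A) (L := L)
    (fun m hm1 hm2 => (hrun m hm1 (by omega)).1) (fun m hm1 hm2 hL => hA m hm1 (by omega) hL)
    (fun m hm1 hm2 hL => hstep m hm1 (by omega) hL) hcert
  omega

end Run

end ResCone

end Summit.ResolutionOfSingularities.ResolutionOfSingularities.Theorems.PIDim4
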